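import Literature.ComputerArithmetic.LangeRump2018.Ufp

/-!
# Lange–Rump 2019, Proposition 1 PROVED: any order, `n - 1 ≤ ½u⁻¹` ⟹ `|ŝ - s| ≤ (n-1)u/(1+(n-1)u)·Σ|xᵢ|`

HONEST FRAMING (venture CertifiedArithmetic / cell `pub-lowprec`): certified error envelopes and
provably optimal rounding/accumulation schemes for low-precision formats under stated cost models;
every table by two implementations; no hardware or vendor claims.

[LangeRump2018, Prop 1] (M. Lange, S. M. Rump, *Sharp estimates for perturbation errors in
summations*, Math. Comp. 88 (2019), radix `β = 2`; quoted as [BoldoEtAl2023, Thm 4.5]): let `s` be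
the result of a floating-point summation of `a₁, …, aₙ ∈ F` in some nearest-addition in arbitrary
order; if `n ≤ 1 + ½u⁻¹` then `|s - Σ aⱼ| ≤ (n-1)u/(1+(n-1)u) · Σ|aⱼ|`. PROVED here over the
number system of `JeannerodRump2018/Summation.lean` (precision `p ≥ 1`, gradual underflow, no
overflow, ANY round-to-nearest map, any tie rule): `proposition1` (and the stronger local-error
form `absErr_le_langeRump`: `Σ_nodes |δ_v| ≤ (n-1)u/(1+(n-1)u)·Σ|aⱼ|`).

THE PROOF is not the paper's Theorem 5 / Lemma 6 route but an equivalent short induction found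
while formalising (first for the cell's bit-level formats, `Summits/…/LowPrec/AccumulateLangeRump`):
with `U = max_v ufp(y_v)` over the node arguments and `v₁` a deepest node attaining `U`, (1) nodes
below `v₁` err by `≤ uU/2` each, (2) `±U ∈ F` forces the leaf mass below `v₁` to be
`≥ U + |δ_{v₁}| - D₀`, (3) every ancestor adds a float to a disjoint subtree `B`, so
`|δ_w| ≤ min(T_B + D_B, uU)`, (4) the bookkeeping `Ufp.base_arith` / `Ufp.step_arith` closes with
`2(n-1)u ≤ 1` used once. Sharpness ([LangeRump2018, Remark 2]: recursive summation of
`(1, u, …, u)` with ties-to-even) is not formalised here.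
-/

namespace Literature.ComputerArithmetic.LangeRump2018

open Literature.ComputerArithmetic.JeannerodRump2018
open Literature.ComputerArithmetic.JeannerodRump2018.SumTree

variable {p : ℕ} {emin : ℤ} {fl : ℚ → ℚ}

/-- THE INDUCTION (leaves in `F`): jointly (B) the spine invariant — for `K ≥ numNodes t`,
`2Ku ≤ 1`, a cap `U` on all node ufps attained at some node:
`Σ|δ_v| - Ku/(1+Ku)·Σ|xᵢ| ≤ -(K - numNodes t)·uU/(1+Ku)` — and (A) the bound
`Σ|δ_v| ≤ k u/(1+k u)·Σ|xᵢ|` for `k = numNodes t ≤ ½u⁻¹`. [cite: LangeRump2018, Prop 1] -/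
theorem spine_induction (hp : 1 ≤ p) (hfl : IsRoundNearest p emin fl) :
    ∀ t : SumTree, (∀ x ∈ t.leaves, IsFloat p emin x) →
      (∀ (K : ℕ) (U : ℚ), numNodes t ≤ K → 2 * (K : ℚ) * unitRoundoff p ≤ 1 →
          AllNodes fl (fun y => ufp p emin y ≤ U) t → SomeNode fl (fun y => ufp p emin y = U) t →
          absErr fl t - (K : ℚ) * unitRoundoff p / (1 + (K : ℚ) * unitRoundoff p) * absSum t
            ≤ -(((K : ℚ) - numNodes t) * (unitRoundoff p * U)
                / (1 + (K : ℚ) * unitRoundoff p))) ∧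
      (2 * (numNodes t : ℚ) * unitRoundoff p ≤ 1 →
          absErr fl t ≤ (numNodes t : ℚ) * unitRoundoff p
            / (1 + (numNodes t : ℚ) * unitRoundoff p) * absSum t)
  | .leaf x, _ => by
      refine ⟨fun K U _ _ _ hS => hS.elim, fun _ => ?_⟩
      simp [absErr, SumTree.localErrors, numNodes, absSum, SumTree.leaves]
  | .node l r, hleaves => by
      have hlF : ∀ x ∈ l.leaves, IsFloat p emin x := fun x hx => hleaves x (by simp [leaves, hx])
      have hrF : ∀ x ∈ r.leaves, IsFloat p emin x := fun x hx => hleaves x (by simp [leaves, hx])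
      obtain ⟨Bl, Al⟩ := spine_induction hp hfl l hlF
      obtain ⟨Br, Ar⟩ := spine_induction hp hfl r hrF
      have hu : 0 < unitRoundoff p := by unfold unitRoundoff; positivity
      have hu2 : 2 * unitRoundoff p ≤ 1 := by
        unfold unitRoundoff
        have : (2 : ℚ) ≤ 2 ^ p := by
          calc (2 : ℚ) = 2 ^ 1 := by norm_num
            _ ≤ 2 ^ p := pow_le_pow_right₀ (by norm_num) hp
        rw [mul_one_div, div_le_one (by positivity)]; exact this
      set u := unitRoundoff p with hu_def
      have hyl := isFloat_eval hfl l hlF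
      have hyr := isFloat_eval hfl r hrF
      set y := eval fl l + eval fl r with hy_def
      set e := |fl y - y| with he_def
      set Dl := absErr fl l
      set Dr := absErr fl r
      set Tl := absSum l
      set Tr := absSum r
      have hDl := absErr_nonneg fl l
      have hDr := absErr_nonneg fl r
      have hTl := absSum_nonneg l
      have hTr := absSum_nonneg r
      have he_ufp : e ≤ u * ufp p emin y := abs_err_add_le_ufp hp hfl hyl hyr
      have he_r : e ≤ |eval fl r| := abs_err_le_abs_operand hfl hyl _
      have he_l : e ≤ |eval fl l| := by
        have := abs_err_le_abs_operand hfl hyr (eval fl l)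
        rw [add_comm] at this; exact this
      have he_fit : e + ufp p emin y ≤ |y| := abs_err_add_ufp_le_abs hp hfl _ _
      have har_le : |eval fl r| ≤ Tr + Dr := abs_eval_le fl r
      have hal_le : |eval fl l| ≤ Tl + Dl := abs_eval_le fl l
      have hnode : (numNodes (SumTree.node l r) : ℚ) = numNodes l + numNodes r + 1 := by
        simp [numNodes]
      have hEnode : absErr fl (SumTree.node l r) = Dl + Dr + e := absErr_node _ _ _
      have hTnode : absSum (SumTree.node l r) = Tl + Tr := absSum_node _ _
      have hB : ∀ (K : ℕ) (U : ℚ), numNodes (SumTree.node l r) ≤ K → 2 * (K : ℚ) * u ≤ 1 →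
          AllNodes fl (fun y => ufp p emin y ≤ U) (.node l r) →
          SomeNode fl (fun y => ufp p emin y = U) (.node l r) →
          absErr fl (.node l r) - (K : ℚ) * u / (1 + (K : ℚ) * u) * absSum (.node l r)
            ≤ -(((K : ℚ) - numNodes (SumTree.node l r)) * (u * U) / (1 + (K : ℚ) * u)) := by
        intro K U hK hKu hAll hSome
        obtain ⟨hal, har, hroot⟩ := hAll
        have hK' : numNodes l + numNodes r + 1 ≤ K := by simpa [numNodes] using hK
        have hU : 0 ≤ U := le_trans (ufp_nonneg p emin y) hroot
        have he_U : e ≤ u * U := le_trans he_ufp (mul_le_mul_of_nonneg_left hroot hu.le)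
        rw [hEnode, hTnode, hnode]
        by_cases hsl : SomeNode fl (fun y => ufp p emin y = U) l
        · have h1 := Bl K U (by omega) hKu hal hsl
          have hkr : 2 * (numNodes r : ℚ) * u ≤ 1 := by
            have : (numNodes r : ℚ) ≤ K := by exact_mod_cast (by omega : numNodes r ≤ K)
            nlinarith
          have h2 := step_arith (kB := numNodes r) (K := K) hu hu2 hU hKu (by omega)
            hTr hDr (Ar hkr) (le_trans he_r har_le) he_U
          have e1 : Dl + Dr + e - (K : ℚ) * u / (1 + (K : ℚ) * u) * (Tl + Tr)
              = (Dl - (K : ℚ) * u / (1 + (K : ℚ) * u) * Tl)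
                + (Dr + e - (K : ℚ) * u / (1 + (K : ℚ) * u) * Tr) := by ring
          have e2 : -(((K : ℚ) - numNodes l) * (u * U) / (1 + (K : ℚ) * u))
                + ((numNodes r : ℚ) + 1) * (u * U) / (1 + (K : ℚ) * u)
              = -(((K : ℚ) - (numNodes l + numNodes r + 1)) * (u * U) / (1 + (K : ℚ) * u)) := by
            ring
          rw [e1, ← e2]
          exact add_le_add h1 h2
        by_cases hsr : SomeNode fl (fun y => ufp p emin y = U) r
        · have h1 := Br K U (by omega) hKu har hsr
          have hkl : 2 * (numNodes l : ℚ) * u ≤ 1 := by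
            have : (numNodes l : ℚ) ≤ K := by exact_mod_cast (by omega : numNodes l ≤ K)
            nlinarith
          have h2 := step_arith (kB := numNodes l) (K := K) hu hu2 hU hKu (by omega)
            hTl hDl (Al hkl) (le_trans he_l hal_le) he_U
          have e1 : Dl + Dr + e - (K : ℚ) * u / (1 + (K : ℚ) * u) * (Tl + Tr)
              = (Dr - (K : ℚ) * u / (1 + (K : ℚ) * u) * Tr)
                + (Dl + e - (K : ℚ) * u / (1 + (K : ℚ) * u) * Tl) := by ring
          have e2 : -(((K : ℚ) - numNodes r) * (u * U) / (1 + (K : ℚ) * u))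
                + ((numNodes l : ℚ) + 1) * (u * U) / (1 + (K : ℚ) * u)
              = -(((K : ℚ) - (numNodes l + numNodes r + 1)) * (u * U) / (1 + (K : ℚ) * u)) := by
            ring
          rw [e1, ← e2]
          exact add_le_add h1 h2
        · have hroot_eq : ufp p emin y = U := by
            rcases hSome with h | h | h
            · exact absurd h hsl
            · exact absurd h hsr
            · exact h
          have below : ∀ {t : SumTree}, AllNodes fl (fun y => ufp p emin y ≤ U) t →
              ¬ SomeNode fl (fun y => ufp p emin y = U) t →
              AllNodes fl (fun y => ufp p emin y ≤ U / 2) t := by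
            intro t h1 h2
            refine AllNodes.mono (fun z hz => ?_) t (AllNodes.and_not t h1 h2)
            have hlt : ufp p emin z < ufp p emin y := by
              rw [hroot_eq]; exact lt_of_le_of_ne hz.1 hz.2
            have := two_mul_ufp_le_of_lt hlt
            rw [hroot_eq] at this
            linarith
          have cl := absErr_le_numNodes_mul hp hfl l hlF (below hal hsl)
          have cr := absErr_le_numNodes_mul hp hfl r hrF (below har hsr)
          have hD₀ : Dl + Dr ≤ ((numNodes l + numNodes r : ℕ) : ℚ) * (u * (U / 2)) := by
            push_cast; linarith
          have hT : U + e - (Dl + Dr) ≤ Tl + Tr := by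
            have h1 : |SumTree.exact l + SumTree.exact r| ≤ Tl + Tr := by
              rw [← absSum_node]; exact abs_exact_le_absSum (.node l r)
            have h2 := abs_eval_sub_exact_le fl l
            have h3 := abs_eval_sub_exact_le fl r
            have h4 : |y| ≤ |SumTree.exact l + SumTree.exact r| + Dl + Dr := by
              have : y = (SumTree.exact l + SumTree.exact r)
                  + ((eval fl l - SumTree.exact l) + (eval fl r - SumTree.exact r)) := by
                rw [hy_def]; ring
              rw [this]
              refine le_trans (abs_add_le _ _) ?_
              have := abs_add_le (eval fl l - SumTree.exact l) (eval fl r - SumTree.exact r)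
              linarith
            rw [hroot_eq] at he_fit
            linarith
          have := base_arith (m := numNodes l + numNodes r) (K := K) hu hKu
            (by omega) (add_nonneg hDl hDr) hD₀ he_U hT
          push_cast at this
          linarith
      refine ⟨hB, fun hk => ?_⟩
      have := hB (numNodes (.node l r)) (maxUfp p emin fl (.node l r)) le_rfl hk
        (allNodes_ufp_le_maxUfp _) (someNode_ufp_eq_maxUfp _ (by simp [numNodes]))
      simp only [sub_self, zero_mul, zero_div, neg_zero, sub_nonpos] at this
      exact this

/-- PROPOSITION 1, local-error form: leaves in `F`, `2(n-1)u ≤ 1` ⟹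
`Σ_nodes |δ_v| ≤ (n-1)u/(1+(n-1)u) · Σ|aⱼ|`. [cite: LangeRump2018, Prop 1] -/
theorem absErr_le_langeRump (hp : 1 ≤ p) (hfl : IsRoundNearest p emin fl) (t : SumTree)
    (hleaves : ∀ x ∈ t.leaves, IsFloat p emin x)
    (hk : 2 * ((t.leaves.length : ℚ) - 1) * unitRoundoff p ≤ 1) :
    absErr fl t ≤ ((t.leaves.length : ℚ) - 1) * unitRoundoff p
      / (1 + ((t.leaves.length : ℚ) - 1) * unitRoundoff p) * absSum t := by
  rw [← numNodes_cast] at hk ⊢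
  exact (spine_induction hp hfl t hleaves).2 hk

/-- PROPOSITION 1 [LangeRump2018] (radix 2): for `a₁ … aₙ ∈ F` summed in round-to-nearest in
ARBITRARY order (evaluation tree `t`), if `n ≤ 1 + ½u⁻¹` then
`|s - Σ aⱼ| ≤ (n-1)u/(1+(n-1)u) · Σ|aⱼ|`. Precision `p ≥ 1`, gradual underflow, any tie rule.
[cite: LangeRump2018, Prop 1] -/
theorem proposition1 (hp : 1 ≤ p) (hfl : IsRoundNearest p emin fl) (t : SumTree)
    (hleaves : ∀ x ∈ t.leaves, IsFloat p emin x)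
    (hn : 2 * ((t.leaves.length : ℚ) - 1) * unitRoundoff p ≤ 1) :
    |t.eval fl - t.exact| ≤ ((t.leaves.length : ℚ) - 1) * unitRoundoff p
      / (1 + ((t.leaves.length : ℚ) - 1) * unitRoundoff p) * (t.leaves.map abs).sum :=
  le_trans (abs_eval_sub_exact_le fl t) (absErr_le_langeRump hp hfl t hleaves hn)

end Literature.ComputerArithmetic.LangeRump2018
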